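import Literature.AnabelianGeometry.SemiGraphs.PSCGraphicity
import Literature.IUT.HodgeTheaters.CoveringsErrataVerticial
import HarnessLib

/-!
# [CombGC] Theorem 1.6 (ii), (iii): the two "immediate" directions, PROVED over the interface

Mochizuki, *A combinatorial version of the Grothendieck conjecture* [CombGC], proof of Theorem 1.6,
author's manuscript p. 14: (ii) "`α` is graphic if and only if it is graphically filtration-preserving
… Necessity is immediate"; (iii) "`β` is verticially filtration-preserving if and only if it is
group-theoretically verticial … Sufficiency is immediate" (the latter sentence as re-issued in
[IUTchI] Remark 1.2.3 (vii), kurims manuscript p. 43).  Proof-only companion of abc-iut-L3-t4's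
`PSCGraphicity.lean` (abc-iut cell; written by abc-iut-L5-t6 at abc-iut-L3-lead's invitation
20:45:33Z), for ALL `PSCDatum`s — no origin predicate, no sturdiness:

* `PSCDatum.isGraphicallyFiltrationPreserving_of_isGraphic` — Thm. 1.6 (ii), necessity: a graphic
  `α : Π_G ⥲ Π_H` is graphically (verticially and edge-wise) filtration-preserving.  Mechanism: `α` is a
  homeomorphic isomorphism, so `map α` commutes with topological closure, commutators and `⊓`, and a
  graphic `α` carries the verticial (resp. nodal, cuspidal) subgroups of `Π_G` onto those of `Π_H`
  (`IsGraphicVia` read in both directions through the bijection `ι` of underlying semi-graphs).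
* Thm. 1.6 (iii), sufficiency ("Sufficiency is immediate" = [IUTchI] Rmk. 1.2.3 (vii)) is
  `Literature.IUT.HodgeTheaters.Rmk123.isUnrVerticiallyFiltrationPreserving_of_isUnrGroupTheoreticallyVerticial`
  (`IUT/HodgeTheaters/CoveringsErrataVerticial.lean`, abc-iut-L5-t6, p407531; imported here, not
  restated — the gate's dedup forbids a re-export).

The hard directions (Thm. 1.6 (i); (ii) sufficiency; (iii) necessity) are NOT touched: they are the
content of [CombGC] §1 and stay named facts (`…Holds Ω`) of `PSCGraphicity.lean`.  Nothing here takes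
a side on [IUTchIII] Cor. 3.12.
-/

noncomputable section

open scoped Pointwise
open Topology

namespace Literature.AnabelianGeometry.SemiGraphs

namespace PSCDatum

universe u

variable {P : Type u} [Group P] [TopologicalSpace P] [IsTopologicalGroup P]
variable {P' : Type u} [Group P'] [TopologicalSpace P'] [IsTopologicalGroup P']

omit [TopologicalSpace P] [IsTopologicalGroup P] [TopologicalSpace P'] [IsTopologicalGroup P'] in
/-- A homomorphism carries a conjugate `γ • S` to the conjugate of the image by the image of the
conjugator. [cite: MochizukiCombGC2007, Def 1.4(i) p.10] -/
theorem map_conjAct_smul (f : P →* P') (γ : ConjAct P) (S : Subgroup P) :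
    (γ • S).map f = (ConjAct.toConjAct (f (ConjAct.ofConjAct γ))) • S.map f := by
  simp only [Subgroup.pointwise_smul_def, Subgroup.map_map]
  congr 1
  ext x
  simp [ConjAct.smul_def, map_mul, map_inv]

/-! ### A graphic isomorphism transports verticial, nodal and cuspidal subgroups -/

section Transport

variable (G : PSCDatum P) (H : PSCDatum P') (α : P ≃ₜ* P') {ι : PSCSemiGraph.Iso G.graph H.graph}

omit [TopologicalSpace P] [IsTopologicalGroup P] [TopologicalSpace P'] [IsTopologicalGroup P'] in
/-- Transport of a conjugacy class of subgroups along an isomorphism: if `f(S) = δ₀ • T` then every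
conjugate of `S` maps to a conjugate of `T` and every conjugate of `T` is the image of a conjugate of
`S` (`f` an isomorphism). [cite: MochizukiCombGC2007, Def 1.4(i) p.10] -/
theorem conj_transport (f : P ≃* P') {S : Subgroup P} {T : Subgroup P'} {δ₀ : ConjAct P'}
    (h : S.map f.toMonoidHom = δ₀ • T) :
    (∀ γ : ConjAct P, ∃ δ : ConjAct P', (γ • S).map f.toMonoidHom = δ • T) ∧
      ∀ δ : ConjAct P', ∃ γ : ConjAct P, (γ • S).map f.toMonoidHom = δ • T := by
  constructor
  · intro γ
    exact ⟨_, by rw [map_conjAct_smul, h, smul_smul]⟩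
  · intro δ
    refine ⟨ConjAct.toConjAct (f.symm (ConjAct.ofConjAct (δ * δ₀⁻¹))), ?_⟩
    rw [map_conjAct_smul, h, smul_smul, ConjAct.ofConjAct_toConjAct, MulEquiv.coe_toMonoidHom,
      MulEquiv.apply_symm_apply, ConjAct.toConjAct_ofConjAct, inv_mul_cancel_right]

omit [IsTopologicalGroup P] [IsTopologicalGroup P'] in
/-- A graphic `α` maps verticial subgroups to verticial subgroups. [cite: MochizukiCombGC2007, Def 1.4(i) p.10] -/
theorem IsGraphicVia.isVerticial_map (h : G.IsGraphicVia H α ι) {B : Subgroup P}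
    (hB : G.IsVerticial B) : H.IsVerticial (B.map α.toMulEquiv.toMonoidHom) := by
  obtain ⟨v, γ, rfl⟩ := hB
  obtain ⟨δ₀, hδ₀⟩ := h.1 v
  obtain ⟨δ, hδ⟩ := (conj_transport α.toMulEquiv hδ₀).1 γ
  exact ⟨ι.vertEquiv v, δ, hδ⟩

omit [IsTopologicalGroup P] [IsTopologicalGroup P'] in
/-- Every verticial subgroup of `Π_H` is the image of a verticial subgroup of `Π_G` under a graphic
`α`. [cite: MochizukiCombGC2007, Def 1.4(i) p.10] -/
theorem IsGraphicVia.exists_isVerticial_map_eq (h : G.IsGraphicVia H α ι) {C : Subgroup P'}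
    (hC : H.IsVerticial C) : ∃ B : Subgroup P, G.IsVerticial B ∧ B.map α.toMulEquiv.toMonoidHom = C := by
  obtain ⟨w, δ, rfl⟩ := hC
  obtain ⟨v, rfl⟩ := ι.vertEquiv.surjective w
  obtain ⟨δ₀, hδ₀⟩ := h.1 v
  obtain ⟨γ, hγ⟩ := (conj_transport α.toMulEquiv hδ₀).2 δ
  exact ⟨γ • G.vertGp v, ⟨v, γ, rfl⟩, hγ⟩

omit [IsTopologicalGroup P] [IsTopologicalGroup P'] in
/-- A graphic `α` maps edge-like subgroups to edge-like subgroups. [cite: MochizukiCombGC2007, Def 1.4(i) p.10] -/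
theorem IsGraphicVia.isEdgeLike_map (h : G.IsGraphicVia H α ι) {B : Subgroup P}
    (hB : G.IsEdgeLike B) : H.IsEdgeLike (B.map α.toMulEquiv.toMonoidHom) := by
  rcases hB with ⟨e, γ, rfl⟩ | ⟨c, γ, rfl⟩
  · obtain ⟨δ₀, hδ₀⟩ := h.2.1 e
    obtain ⟨δ, hδ⟩ := (conj_transport α.toMulEquiv hδ₀).1 γ
    exact Or.inl ⟨ι.nodeEquiv e, δ, hδ⟩
  · obtain ⟨δ₀, hδ₀⟩ := h.2.2 c
    obtain ⟨δ, hδ⟩ := (conj_transport α.toMulEquiv hδ₀).1 γ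
    exact Or.inr ⟨ι.cuspEquiv c, δ, hδ⟩

omit [IsTopologicalGroup P] [IsTopologicalGroup P'] in
/-- Every edge-like subgroup of `Π_H` is the image of an edge-like subgroup of `Π_G` under a graphic
`α`. [cite: MochizukiCombGC2007, Def 1.4(i) p.10] -/
theorem IsGraphicVia.exists_isEdgeLike_map_eq (h : G.IsGraphicVia H α ι) {C : Subgroup P'}
    (hC : H.IsEdgeLike C) : ∃ B : Subgroup P, G.IsEdgeLike B ∧ B.map α.toMulEquiv.toMonoidHom = C := by
  rcases hC with ⟨e', δ, rfl⟩ | ⟨c', δ, rfl⟩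
  · obtain ⟨e, rfl⟩ := ι.nodeEquiv.surjective e'
    obtain ⟨δ₀, hδ₀⟩ := h.2.1 e
    obtain ⟨γ, hγ⟩ := (conj_transport α.toMulEquiv hδ₀).2 δ
    exact ⟨γ • G.nodeGp e, Or.inl ⟨e, γ, rfl⟩, hγ⟩
  · obtain ⟨c, rfl⟩ := ι.cuspEquiv.surjective c'
    obtain ⟨δ₀, hδ₀⟩ := h.2.2 c
    obtain ⟨γ, hγ⟩ := (conj_transport α.toMulEquiv hδ₀).2 δ
    exact ⟨γ • G.cuspGp c, Or.inr ⟨c, γ, rfl⟩, hγ⟩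

end Transport

/-! ### Filtration subgroups along a homeomorphic isomorphism -/

/-- The image under a homeomorphic isomorphism `e` of `closure([U,U] ⊔ ⨆{A | q A})` is
`closure([e U, e U] ⊔ ⨆{A' | q' A'})` as soon as `e` carries the generators `{A | q A}` onto the
generators `{A' | q' A'}`. [cite: MochizukiCombGC2007, Def 1.1(ii) p.7] -/
theorem map_filtration_eq (e : P ≃ₜ* P') (U : Subgroup P) (q : Subgroup P → Prop)
    (q' : Subgroup P' → Prop) (h1 : ∀ A, q A → q' (A.map e.toMulEquiv.toMonoidHom))
    (h2 : ∀ A', q' A' → ∃ A, q A ∧ A.map e.toMulEquiv.toMonoidHom = A') :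
    ((⁅U, U⁆ ⊔ ⨆ A : {A : Subgroup P // q A}, (A : Subgroup P)).topologicalClosure).map
        e.toMulEquiv.toMonoidHom =
      (⁅U.map e.toMulEquiv.toMonoidHom, U.map e.toMulEquiv.toMonoidHom⁆ ⊔
        ⨆ A' : {A' : Subgroup P' // q' A'}, (A' : Subgroup P')).topologicalClosure := by
  rw [Literature.IUT.HodgeTheaters.Rmk123.map_continuousMulEquiv_topologicalClosure,
    Subgroup.map_sup, Subgroup.map_commutator, Subgroup.map_iSup]
  congr 2
  refine le_antisymm (iSup_le fun A => ?_) (iSup_le fun A' => ?_)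
  · exact le_iSup_of_le ⟨(A : Subgroup P).map e.toMulEquiv.toMonoidHom, h1 A A.2⟩ le_rfl
  · obtain ⟨A, hA, hAA'⟩ := h2 A' A'.2
    exact le_iSup_of_le ⟨A, hA⟩ (by rw [hAA'])

/-! ### Theorem 1.6 (ii): graphic ⇒ graphically filtration-preserving -/

/-- **[CombGC] Theorem 1.6 (ii), necessity** ("Necessity is immediate", proof p. 14): a graphic
isomorphism `α : Π_G ⥲ Π_H` is verticially filtration-preserving — for all `PSCDatum`s.
[cite: MochizukiCombGC2007, Thm 1.6(ii) p.13] -/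
theorem isVerticiallyFiltrationPreserving_of_isGraphic (G : PSCDatum P) (H : PSCDatum P')
    (α : P ≃ₜ* P') (h : G.IsGraphic H α) : G.IsVerticiallyFiltrationPreserving H α := by
  obtain ⟨ι, hι⟩ := h
  intro U _hU
  simp only [PSCDatum.vertFil]
  refine map_filtration_eq α U (G.IsVerticialIn U) (H.IsVerticialIn (U.map α.toMulEquiv.toMonoidHom))
    ?_ ?_
  · intro A hA
    obtain ⟨B, hB, rfl⟩ : ∃ B, G.IsVerticial B ∧ A = U ⊓ B := hA
    exact ⟨B.map α.toMulEquiv.toMonoidHom, IsGraphicVia.isVerticial_map G H α hι hB,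
      Subgroup.map_inf _ _ _ α.injective⟩
  · intro A' hA'
    obtain ⟨C, hC, rfl⟩ : ∃ C, H.IsVerticial C ∧ A' = U.map α.toMulEquiv.toMonoidHom ⊓ C := hA'
    obtain ⟨B, hB, rfl⟩ := IsGraphicVia.exists_isVerticial_map_eq G H α hι hC
    exact ⟨U ⊓ B, ⟨B, hB, rfl⟩, Subgroup.map_inf _ _ _ α.injective⟩

/-- **[CombGC] Theorem 1.6 (ii), necessity**: a graphic `α` is edge-wise filtration-preserving — for
all `PSCDatum`s. [cite: MochizukiCombGC2007, Thm 1.6(ii) p.13] -/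
theorem isEdgewiseFiltrationPreserving_of_isGraphic (G : PSCDatum P) (H : PSCDatum P')
    (α : P ≃ₜ* P') (h : G.IsGraphic H α) : G.IsEdgewiseFiltrationPreserving H α := by
  obtain ⟨ι, hι⟩ := h
  intro U _hU
  simp only [PSCDatum.edgeFil]
  refine map_filtration_eq α U (G.IsEdgeLikeIn U) (H.IsEdgeLikeIn (U.map α.toMulEquiv.toMonoidHom))
    ?_ ?_
  · intro A hA
    obtain ⟨B, hB, rfl⟩ : ∃ B, G.IsEdgeLike B ∧ A = U ⊓ B := hA
    exact ⟨B.map α.toMulEquiv.toMonoidHom, IsGraphicVia.isEdgeLike_map G H α hι hB,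
      Subgroup.map_inf _ _ _ α.injective⟩
  · intro A' hA'
    obtain ⟨C, hC, rfl⟩ : ∃ C, H.IsEdgeLike C ∧ A' = U.map α.toMulEquiv.toMonoidHom ⊓ C := hA'
    obtain ⟨B, hB, rfl⟩ := IsGraphicVia.exists_isEdgeLike_map_eq G H α hι hC
    exact ⟨U ⊓ B, ⟨B, hB, rfl⟩, Subgroup.map_inf _ _ _ α.injective⟩

/-- **[CombGC] Theorem 1.6 (ii), necessity** ("`α` is graphic [⇒] it is graphically
filtration-preserving … Necessity is immediate", p. 14), PROVED for all `PSCDatum`s `G`, `H` and all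
`α : Π_G ⥲ Π_H`. [cite: MochizukiCombGC2007, Thm 1.6(ii) p.13] -/
theorem isGraphicallyFiltrationPreserving_of_isGraphic (G : PSCDatum P) (H : PSCDatum P')
    (α : P ≃ₜ* P') (h : G.IsGraphic H α) : G.IsGraphicallyFiltrationPreserving H α :=
  ⟨isVerticiallyFiltrationPreserving_of_isGraphic G H α h,
    isEdgewiseFiltrationPreserving_of_isGraphic G H α h⟩

end PSCDatum

end Literature.AnabelianGeometry.SemiGraphs

end
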